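import Mathlib

/-!
# LINE L13 «DBR POLYNOMIAL DOOR» — node 1: a real zero of `E_p = p + i p′` is a common zero of `p` and `p′`

Cell rh-split, route `DeBrangesSuzukiDoor`, item `stmt-RiemannHypothesis-21496` (`PolyDoorRealAxis`, registrar
rh-split-dbr-neg g16, skeleton `LineDbrB0.lean`).  For a real polynomial `p` and a real point `x`, the polynomial
door `E_p := p_ℂ + i·p_ℂ′` (with `p_ℂ = p.map (algebraMap ℝ ℂ)`) satisfies `E_p(x) = p(x) + i·p′(x)` with both
summands real, so `E_p(x) = 0` forces `p(x) = 0` and `p′(x) = 0`.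

The statement is proved BY VALUE (the item's `payload.signature` verbatim): the route file does not yet declare
`PolyDoorRealAxis`; once it does, the by-name form is `Iff.rfl` away.  Classical (Hermite–Biehler bookkeeping,
Levin 1964 ch. VII); E-GENERAL, RH-free, Mathlib only.
HONEST LABEL: known mathematics, RECORD line, 0 summit credit; nothing here bears on the truth of RH.
-/

set_option linter.dupNamespace false

namespace Summit.RiemannHypothesis.RiemannHypothesis.Theorems.Splittings.PolyDoorRealAxis

open Polynomial

/-- The complexified polynomial evaluated at a real point is the real value, cast. [folklore] -/
theorem eval_map_ofReal (p : ℝ[X]) (x : ℝ) :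
    (p.map (algebraMap ℝ ℂ)).eval (x : ℂ) = ((p.eval x : ℝ) : ℂ) := by
  rw [Polynomial.eval_map, ← Complex.coe_algebraMap, Polynomial.eval₂_at_apply]

/-- The derivative of the complexified polynomial at a real point is the real derivative value, cast.
[folklore] -/
theorem eval_derivative_map_ofReal (p : ℝ[X]) (x : ℝ) :
    (derivative (p.map (algebraMap ℝ ℂ))).eval (x : ℂ) = (((derivative p).eval x : ℝ) : ℂ) := by
  rw [Polynomial.derivative_map, eval_map_ofReal]

/-- **Node 1 of LINE L13 (item `stmt-RiemannHypothesis-21496`, `PolyDoorRealAxis` by value).**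
A real zero `x` of the polynomial door `E_p = p_ℂ + i·p_ℂ′` is a common zero of `p` and `p′`:
`E_p(x) = p(x) + i p′(x)` with `p(x), p′(x) ∈ ℝ`, so real and imaginary parts vanish separately.
[folklore] (Hermite–Biehler bookkeeping; Levin, *Distribution of zeros of entire functions*, ch. VII.) -/
theorem polyDoorRealAxis :
    ∀ (p : Polynomial ℝ) (x : ℝ), (p.map (algebraMap ℝ ℂ) + Polynomial.C Complex.I *
      Polynomial.derivative (p.map (algebraMap ℝ ℂ))).eval (x : ℂ) = 0 →
      p.eval x = 0 ∧ (Polynomial.derivative p).eval x = 0 := by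
  intro p x h
  rw [eval_add, eval_mul, eval_C, eval_map_ofReal, eval_derivative_map_ofReal] at h
  have hre := congrArg Complex.re h
  have him := congrArg Complex.im h
  simp only [Complex.add_re, Complex.ofReal_re, Complex.mul_re, Complex.I_re, zero_mul, Complex.I_im,
    Complex.ofReal_im, mul_zero, sub_zero, add_zero, Complex.zero_re, Complex.add_im, Complex.mul_im,
    one_mul, zero_add, Complex.zero_im] at hre him
  exact ⟨hre, him⟩

end Summit.RiemannHypothesis.RiemannHypothesis.Theorems.Splittings.PolyDoorRealAxis
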